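import Literature.AnabelianGeometry.SemiGraphs.ImageApproximator
import Literature.AnabelianGeometry.SemiGraphs.Commensurability
import Literature.AnabelianGeometry.Anabelioids.ImageProofs
import Literature.AnabelianGeometry.Anabelioids.ExactFunctorProofs
import Literature.AnabelianGeometry.Anabelioids.FiberFunctorUnique

/-!
# [SemiAnbd] Remark 2.3.1: approximators may be taken `π₁`-epimorphic — proof

Mochizuki, *Semi-graphs of anabelioids*, Publ. RIMS **42** (2006), Remark 2.3.1 p. 25
[cite: MochizukiSemiAnbd2006, Rem. 2.3.1 p.25]: "by replacing the constituent anabelioids of `𝒢'`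
by the image anabelioids [cf. [Mzk8], Definition 1.1.7, (i)] of the constituent anabelioids of
`𝒢`, one may always take the approximator of Definition 2.3, (iii), to be `π₁`-epimorphic."

Discharges the named fact `SemiGraphOfAnabelioids.remark_2_3_1` (`Commensurability.lean`):
`remark_2_3_1_holds`.  Given an approximator `φ₀ : 𝒢 → 𝒢₀` splitting a collection of coverings
`𝒞` (Def. 2.3 (iii)), the morphism `φ₀.toImageAnabelioids : 𝒢 → φ₀.imageAnabelioids` onto the
semi-graph of image anabelioids (`ImageApproximator.lean`) is

* `π₁`-epimorphic on every constituent — [GeoAn] p. 14, `π₁(X) ↠ π₁(I_φ)`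
  (`image_factorization_surjective_holds`, abc-iut-L3-t9);
* still splits `𝒞` — `Ker(π₁(𝒢_c) → π₁(I_c)) = Ker(π₁(𝒢_c) → π₁(𝒢₀_c))` (`image_factorization_holds`);
* an approximator: identity on `𝔾`, and `φ₀.imageAnabelioids` is of bounded order —
  `π₁(I_v) ≅ π₁(𝒢_v)/Ker ≅ Im(π₁(𝒢_v) → π₁(𝒢₀,v)) ≤ π₁(𝒢₀,v)`, finite of order dividing the bound
  of `𝒢₀` — and of injective type, because `π₁(I_e) → π₁(I_v)` is the restriction of the
  injection `π₁(𝒢₀,e) ↪ π₁(𝒢₀,v)` to the images (a diagram chase through the 2-isomorphism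
  `(φ₀)_b`, `imageAnabelioids_isOfInjectiveType`).

Proof-only; classical.
-/

namespace Literature.AnabelianGeometry.Anabelioids

open CategoryTheory CategoryTheory.Limits CategoryTheory.PreGaloisCategory

universe w v₁ v₂ v₃ u₁ u₂ u₃

section Pi1Map

variable {X : Type u₁} [Category.{v₁} X] {Y : Type u₂} [Category.{v₂} Y] {Z : Type u₃}
  [Category.{v₃} Z]

/-- Functoriality of `π₁(-)` in the morphism: `π₁(ψ ∘ φ) = π₁(ψ) ∘ π₁(φ)` (pull-back functors
compose in the opposite order). [cite: MochizukiGeoAn2004, Def. 1.1.2(ii) p.10] -/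
theorem pi1Map_comp_apply (Q : Z ⥤ Y) (P : Y ⥤ X) (F : X ⥤ FintypeCat.{w}) (σ : Aut F) :
    pi1Map (Q ⋙ P) F σ = pi1Map Q (P ⋙ F) (pi1Map P F σ) := rfl

/-- Isomorphic pull-back functors induce conjugate homomorphisms on fundamental groups: for
`α : Q ≅ Q'`, `π₁(Q') = (α ⋆ F)-conjugation ∘ π₁(Q)` ([GeoAn] Rem. 1.1.2.1: 2-isomorphic
1-morphisms). [cite: MochizukiGeoAn2004, Def. 1.1.2(ii) p.10] -/
theorem pi1Map_eq_conjAut_of_iso {Q Q' : Y ⥤ X} (α : Q ≅ Q') (F : X ⥤ FintypeCat.{w})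
    (σ : Aut F) :
    pi1Map Q' F σ = (Functor.isoWhiskerRight α F).conjAut (pi1Map Q F σ) := by
  have hcomm : (Functor.isoWhiskerRight α F).hom ≫ (pi1Map Q' F σ).hom =
      (pi1Map Q F σ).hom ≫ (Functor.isoWhiskerRight α F).hom := by
    ext B : 2
    simp only [Functor.isoWhiskerRight_hom, Functor.whiskerRight_app, NatTrans.comp_app,
      pi1Map_hom_app]
    exact σ.hom.naturality (α.hom.app B)
  refine Iso.ext ?_
  rw [Iso.conjAut_hom, Iso.conj_apply, ← hcomm, Iso.inv_hom_id_assoc]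

/-- In particular `π₁(Q) σ = 1 ↔ π₁(Q') σ = 1` for isomorphic `Q ≅ Q'`.
[cite: MochizukiGeoAn2004, Def. 1.1.2(ii) p.10] -/
theorem pi1Map_eq_one_iff_of_iso {Q Q' : Y ⥤ X} (α : Q ≅ Q') (F : X ⥤ FintypeCat.{w})
    (σ : Aut F) : pi1Map Q F σ = 1 ↔ pi1Map Q' F σ = 1 := by
  rw [pi1Map_eq_conjAut_of_iso α, MulEquiv.map_eq_one_iff]

end Pi1Map

section ImageOrder

variable {X : Type u₁} [Category.{v₁} X] {Y : Type u₂} [Category.{v₂} Y] [GaloisCategory X]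
  [GaloisCategory Y] (φ : Hom X Y)

/-- **`π₁(I_φ)` is a quotient of `π₁(X)` embedding into `π₁(Y)`**: for a basepoint `β` of `X`,
`π₁(I_φ, ι ∘ β) ≃ Im(π₁(X, β) → π₁(Y, φ ∘ β))` (from the two halves of the factorisation
`π₁(X) ↠ π₁(I_φ) ↪ π₁(Y)`, [GeoAn] p. 14). [cite: MochizukiGeoAn2004, §1.1 p.14] -/
theorem nonempty_aut_imageι_mulEquiv_range (F : X ⥤ FintypeCat.{v₁}) [FiberFunctor F] :
    Nonempty (Aut ((imageObj φ.pullback).ι ⋙ F) ≃* (pi1Map φ.pullback F).range) := by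
  have hs := pi1Map_imageIncl_surjective φ F
  have hker : (pi1Map φ.pullback F).ker = (pi1Map (imageObj φ.pullback).ι F).ker :=
    image_factorization_holds X Y φ F
  exact ⟨((QuotientGroup.quotientKerEquivOfSurjective _ hs).symm.trans
    (QuotientGroup.quotientMulEquivOfEq hker.symm)).trans (QuotientGroup.quotientKerEquivRange _)⟩

/-- **The fundamental group of `I_φ` is finite of order dividing that of `π₁(Y)`** when the latter
is finite — at every basepoint of `I_φ`. [cite: MochizukiGeoAn2004, §1.1 p.14] -/
theorem finite_aut_image_and_card_dvd (F₁ : X ⥤ FintypeCat.{v₁}) [FiberFunctor F₁]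
    (hfin : Finite (Aut (φ.pullback ⋙ F₁))) (F : Image φ.pullback ⥤ FintypeCat.{v₁})
    [FiberFunctor F] : Finite (Aut F) ∧ Nat.card (Aut F) ∣ Nat.card (Aut (φ.pullback ⋙ F₁)) := by
  haveI : FiberFunctor ((imageObj φ.pullback).ι ⋙ F₁) := fiberFunctor_comp_of_exact _ _
  obtain ⟨eF⟩ := nonempty_iso_of_fiberFunctor F ((imageObj φ.pullback).ι ⋙ F₁)
  obtain ⟨e⟩ := nonempty_aut_imageι_mulEquiv_range φ F₁
  have e' : Aut F ≃ (pi1Map φ.pullback F₁).range := eF.conjAut.toEquiv.trans e.toEquiv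
  haveI := hfin
  refine ⟨Finite.of_equiv _ e'.symm, ?_⟩
  rw [Nat.card_congr e']
  exact Subgroup.card_subgroup_dvd_card _

end ImageOrder

end Literature.AnabelianGeometry.Anabelioids

namespace Literature.AnabelianGeometry.SemiGraphs

open CategoryTheory CategoryTheory.Limits CategoryTheory.PreGaloisCategory
open Literature.AnabelianGeometry.Anabelioids

universe v₁ u₁ u

namespace SemiGraphOfAnabelioids

variable {𝒢 𝒢₀ : SemiGraphOfAnabelioids.{v₁, u₁, u}} (φ₀ : Hom 𝒢 𝒢₀)

/-- The kernel of `π₁` of an edge component does not depend on how its target edge is indexed.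
[cite: MochizukiSemiAnbd2006, Rem. 2.4.2 p.26] -/
theorem Hom.pi1Map_φE_eq_one_iff (e : 𝒢.graph.Edge) (f : 𝒢₀.graph.Edge)
    (hf : φ₀.base.edgeMap e = f) (F : 𝒢.E e ⥤ FintypeCat.{v₁}) (σ : Aut F) :
    pi1Map (φ₀.φE e f hf).pullback F σ = 1 ↔
      pi1Map (φ₀.φE e (φ₀.base.edgeMap e) rfl).pullback F σ = 1 := by
  subst hf
  rfl

/-- **The vertex components of `𝒢 → φ₀.imageAnabelioids` are `π₁`-epimorphisms**
(`π₁(𝒢_v) ↠ π₁(I_{φ₀,v})`, [GeoAn] p. 14). [cite: MochizukiSemiAnbd2006, Rem. 2.3.1 p.25] -/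
theorem Hom.toImageAnabelioids_isPi1Epi_V (v : 𝒢.graph.Vertex) :
    IsPi1Epi (φ₀.toImageAnabelioids.φV v).pullback := fun F _ =>
  image_factorization_surjective_holds _ _ (φ₀.φV v) F

/-- **The edge components of `𝒢 → φ₀.imageAnabelioids` are `π₁`-epimorphisms.**
[cite: MochizukiSemiAnbd2006, Rem. 2.3.1 p.25] -/
theorem Hom.toImageAnabelioids_isPi1Epi_E (e : 𝒢.graph.Edge) :
    IsPi1Epi (φ₀.toImageAnabelioids.φE e (φ₀.toImageAnabelioids.base.edgeMap e) rfl).pullback := by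
  rw [Hom.toImageAnabelioids_φE]
  exact fun F _ => image_factorization_surjective_holds _ _ (φ₀.φE e _ rfl) F

/-- **`𝒢 → φ₀.imageAnabelioids` splits every collection of coverings that `φ₀` splits**:
`Ker(π₁(𝒢_c) → π₁(I_c)) = Ker(π₁(𝒢_c) → π₁(𝒢₀,c))`. [cite: MochizukiSemiAnbd2006, Rem. 2.3.1 p.25] -/
theorem Hom.toImageAnabelioids_splits {M : ℕ} (𝒞 : CoveringCollection 𝒢 M) (h : φ₀.Splits 𝒞) :
    φ₀.toImageAnabelioids.Splits 𝒞 := by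
  refine ⟨fun v => ?_, fun e => ?_⟩
  · haveI := 𝒞.fiberV v
    show (pi1Map (imageObj (φ₀.φV v).pullback).ι (𝒞.FV v)).ker ≤ 𝒞.UV v
    exact (image_factorization_holds _ _ (φ₀.φV v) (𝒞.FV v)).symm.le.trans (h.1 v)
  · haveI := 𝒞.fiberE e
    rw [Hom.toImageAnabelioids_φE]
    show (pi1Map (imageObj (φ₀.φE e (φ₀.base.edgeMap e) rfl).pullback).ι (𝒞.FE e)).ker ≤ 𝒞.UE e
    exact (image_factorization_holds _ _ (φ₀.φE e _ rfl) (𝒞.FE e)).symm.le.trans (h.2 e)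

/-- **The semi-graph of image anabelioids of a morphism to a semi-graph of anabelioids of
injective type is of injective type**: `π₁(I_e) → π₁(I_v)` is the restriction to the images of the
injection `π₁(𝒢₀,e) ↪ π₁(𝒢₀,v)`, through the 2-isomorphism `(φ₀)_b`.
[cite: MochizukiSemiAnbd2006, Rem. 2.3.1 p.25] -/
theorem Hom.imageAnabelioids_isOfInjectiveType (h₀ : 𝒢₀.IsOfInjectiveType) :
    φ₀.imageAnabelioids.IsOfInjectiveType := by
  refine ⟨fun b v h => ?_⟩
  -- notation; restate the goal in terms of the image anabelioids `I_e ⊆ 𝒢_e`, `I_v ⊆ 𝒢_v`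
  change 𝒢.graph.Branch at b
  change 𝒢.graph.Vertex at v
  change 𝒢.graph.abuts b = some v at h
  let e := 𝒢.graph.edgeOf b
  let ιe := (imageObj (φ₀.φE e (φ₀.base.edgeMap e) rfl).pullback).ι
  let ιv := (imageObj (φ₀.φV v).pullback).ι
  let P := (𝒢.pull b v h).pullback
  show IsPi1Mono (Hom.restrictToImage (𝒢.pull b v h) (φ₀.φV v)
    (imageObj (φ₀.φE e (φ₀.base.edgeMap e) rfl).pullback)
    fun _ hA => φ₀.imageObj_pull_obj b v h hA).pullback
  let F₁ : 𝒢.E e ⥤ FintypeCat.{v₁} := GaloisCategory.getFiberFunctor (𝒢.E e)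
  haveI : FiberFunctor (ιe ⋙ F₁) := fiberFunctor_comp_of_exact _ _
  haveI : FiberFunctor (P ⋙ F₁) := fiberFunctor_comp_of_exact _ _
  rw [isPi1Mono_iff_injective _ (ιe ⋙ F₁), injective_iff_map_eq_one]
  intro x hx
  obtain ⟨y, rfl⟩ := pi1Map_imageIncl_surjective (φ₀.φE e (φ₀.base.edgeMap e) rfl) F₁ x
  -- `π₁(b^*|) ∘ (π₁(𝒢_e) ↠ π₁(I_e)) = (π₁(𝒢_v) ↠ π₁(I_v)) ∘ π₁(b^*)`
  have h1 : pi1Map ιv (P ⋙ F₁) (pi1Map P F₁ y) = 1 := by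
    rw [← pi1Map_comp_apply]
    exact hx
  -- so `π₁(b^*) y` dies in `π₁(𝒢₀,v)`
  have h2 : pi1Map (φ₀.φV v).pullback (P ⋙ F₁) (pi1Map P F₁ y) = 1 := by
    rw [← MonoidHom.mem_ker, image_factorization_holds _ _ (φ₀.φV v) (P ⋙ F₁),
      MonoidHom.mem_ker]
    exact h1
  have h3 : pi1Map ((φ₀.φV v).pullback ⋙ P) F₁ y = 1 := by
    rw [pi1Map_comp_apply]
    exact h2
  -- transport along `(φ₀)_b : φ_v^* ⋙ b^* ≅ b₀^* ⋙ φ_e^*`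
  rw [pi1Map_eq_one_iff_of_iso (φ₀.φB b v h) F₁ y, pi1Map_comp_apply] at h3
  -- `b₀^*` is a `π₁`-monomorphism
  haveI : FiberFunctor ((φ₀.φE (𝒢.graph.edgeOf b) (𝒢₀.graph.edgeOf (φ₀.base.branchMap b))
      (φ₀.base.edgeOf_branchMap b).symm).pullback ⋙ F₁) := fiberFunctor_comp_of_exact _ _
  have h4 := (injective_iff_map_eq_one _).mp
    (h₀.isPi1Mono (φ₀.base.branchMap b) (φ₀.base.vertexMap v) (φ₀.base.abuts_branchMap b v h) _)
    _ h3
  rw [φ₀.pi1Map_φE_eq_one_iff] at h4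
  -- hence `y ∈ Ker(π₁(𝒢_e) → π₁(𝒢₀,e)) = Ker(π₁(𝒢_e) → π₁(I_e))`
  rw [← MonoidHom.mem_ker, ← image_factorization_holds _ _ (φ₀.φE e _ rfl) F₁, MonoidHom.mem_ker]
  exact h4

/-- **The semi-graph of image anabelioids of a morphism to a semi-graph of anabelioids of bounded
order is of bounded order** (with the same bound): `π₁(I_v) ≃ Im(π₁(𝒢_v) → π₁(𝒢₀,v)) ≤ π₁(𝒢₀,v)`.
[cite: MochizukiSemiAnbd2006, Rem. 2.3.1 p.25] -/
theorem Hom.imageAnabelioids_isOfBoundedOrder (h₀ : 𝒢₀.IsOfBoundedOrder) :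
    φ₀.imageAnabelioids.IsOfBoundedOrder := by
  obtain ⟨M, hM, hbd⟩ := h₀.exists_bound
  refine ⟨φ₀.imageAnabelioids_isOfInjectiveType h₀.isOfInjectiveType, M, hM, fun v F hF => ?_⟩
  -- re-read the basepoint `F` of the constituent `I_v` of `φ₀.imageAnabelioids` as one of `I_v`
  change 𝒢.graph.Vertex at v
  change Image (φ₀.φV v).pullback ⥤ FintypeCat.{v₁} at F
  change FiberFunctor (C := Image (φ₀.φV v).pullback) F at hF
  let F₁ : 𝒢.V v ⥤ FintypeCat.{v₁} := GaloisCategory.getFiberFunctor (𝒢.V v)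
  haveI : FiberFunctor ((φ₀.φV v).pullback ⋙ F₁) := fiberFunctor_comp_of_exact _ _
  obtain ⟨hfin, hdvd⟩ := hbd (φ₀.base.vertexMap v) ((φ₀.φV v).pullback ⋙ F₁)
  obtain ⟨hfinF, hdvdF⟩ :=
    finite_aut_image_and_card_dvd (φ₀.φV v) F₁ hfin F
  exact ⟨hfinF, hdvdF.trans hdvd⟩

/-- **`𝒢 → φ₀.imageAnabelioids` is a `π₁`-epimorphic approximator whenever `𝒢₀` is of bounded
order** (in particular whenever `φ₀` is an approximator). [cite: MochizukiSemiAnbd2006, Rem. 2.3.1 p.25] -/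
theorem Hom.toImageAnabelioids_isPi1EpiApproximator (h₀ : 𝒢₀.IsOfBoundedOrder) :
    φ₀.toImageAnabelioids.IsPi1EpiApproximator :=
  { isApproximator :=
      { isIso_base := by
          show IsIso (𝟙 𝒢.graph)
          infer_instance
        isOfBoundedOrder := φ₀.imageAnabelioids_isOfBoundedOrder h₀ }
    isPi1Epi_V := φ₀.toImageAnabelioids_isPi1Epi_V
    isPi1Epi_E := φ₀.toImageAnabelioids_isPi1Epi_E }

/-- NAMED FACT `remark_2_3_1` ([SemiAnbd] Remark 2.3.1), PROVED: for quasi-coherent `𝒢`, every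
bounded collection of finite étale coverings of the components is split by a `π₁`-EPIMORPHIC
approximator — namely `𝒢 → φ₀.imageAnabelioids` for any approximator `φ₀` splitting it.
[cite: MochizukiSemiAnbd2006, Rem. 2.3.1 p.25] -/
theorem remark_2_3_1_holds : remark_2_3_1.{v₁, u₁, u} := by
  intro 𝒢 hqc M hM 𝒞
  obtain ⟨𝒢₀, φ₀, happ, hsplit⟩ := hqc.exists_approximator M hM 𝒞
  exact ⟨φ₀.imageAnabelioids, φ₀.toImageAnabelioids,
    φ₀.toImageAnabelioids_isPi1EpiApproximator happ.isOfBoundedOrder,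
    φ₀.toImageAnabelioids_splits 𝒞 hsplit⟩

end SemiGraphOfAnabelioids

end Literature.AnabelianGeometry.SemiGraphs
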